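import Summits.Ventures.YMGap.Thresholds.StarAdjacency
import HarnessLib

/-!
# Venture YMGap — track (c) «DS»: STAR COUNT SCAFFOLD — the vertex star and its plaquettes in
# coordinates `(direction, orientation)`, and the regrouping «star plaquettes ↔ ordered non-opposite
# star pairs» behind the received-sum count (B4a part 3, B4-BLUEPRINT §4, PLAN R95/R96)

HONEST FRAMING: venture file (cell `pub-ymgap`); pure lattice COMBINATORICS of the discrete torus
`(ℤ/L)^d` (continuing `StarGeometry.lean`, `StarAdjacency.lean`); no measure, no `β`, no estimate, no
clustering/continuum/mass-gap claim. Purpose: the (H2) received sum of the cell's Lemma G array is a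
sum over the boundary links of the `2d(d−1)` star plaquettes at a vertex; this file turns such sums
into finite sums over `(Fin d × Bool)²` (the assembly B4b, seat ds-4, then evaluates the 6/6/6/24
position classes at `d = 4`).

## Contents (`s` a site, `⋆ = DSWindow.vertexStar s`)
* (C1) `vertexStar_eq_image_starLink` (`⋆ = {starLink s μ o}`), `sum_vertexStar_eq_sum_starLink`
  (`Σ_{x ∈ ⋆} g x = Σ_{(μ, o) : Fin d × Bool} g (starLink s μ o)`, `L ≥ 2`), `card_vertexStar` (`= 2d`).
* (C2) `starPlaqOf s μ o ν o' h` — THE star plaquette through the star links of directions `μ ≠ ν`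
  and orientations `o, o'`; `starLink_mem_starPlaqOf_left/right`, `starPlaqOf_mem_starPlaqs`,
  `starLink_ne`, `starPlaqOf_swap` (`L ≥ 3`), `snd_ne_of_mem_starPlaq` (two distinct star links on a
  common plaquette have different directions), `exists_plaq_of_snd_ne`, `exists_starPlaqOf_eq`
  (every star plaquette is a `starPlaqOf`, `L ≥ 3`), `filter_vertexStar_starPlaqOf` (its star links
  are exactly the two named ones).
* (C3) `starPairsOf`, `starPairs`, `starPairs_eq_biUnion`, `sum_starPlaqs_pairs` /
  `sum_starPlaqs_pairs'` — the REGROUPING IDENTITY (`L ≥ 3`):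
  `Σ_{q ∈ starPlaqs s} Σ_{a ∈ q ∩ ⋆} Σ_{b ∈ (q ∩ ⋆) ∖ {a}} k a b = Σ_{a ∈ ⋆} Σ_{b ∈ ⋆, b.2 ≠ a.2} k a b`
  (each ordered non-opposite star pair lies on exactly one star plaquette), for any `k` with values in
  an additive commutative monoid; `sum_starPairs_eq_sum_starLink` (the right side in coordinates
  `(Fin d × Bool)²`, filter `p'.1 ≠ p.1`); `starPairsOf_starPlaqOf`, `sum_starPairsOf_starPlaqOf`
  (the two ordered pairs of one star plaquette).

References: cell `pub-ymgap` ds/ds4/B4-BLUEPRINT.md §2, §4, §6(d); ds/LEAN-KROW.md §1 (4); PLAN R95/R96.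
-/

noncomputable section

open Function Finset
open Literature.MathematicalPhysics.QuantumFieldTheory
open Summit.Ventures.YMGap.DSWindow

namespace Summit.Ventures.YMGap.StarKernel

variable {d L : ℕ} [NeZero L]

/-! ### (C1) The vertex star in coordinates -/

section Coordinates

/-- **The vertex star is the image of `(μ, o) ↦ starLink s μ o`.** -/
theorem vertexStar_eq_image_starLink (s : Site d L) :
    vertexStar s = (univ : Finset (Fin d × Bool)).image fun p => starLink s p.1 p.2 := by
  ext x
  rw [mem_image]
  constructor
  · intro hx
    obtain ⟨o, h⟩ := eq_starLink_of_mem_vertexStar hx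
    exact ⟨(x.2, o), mem_univ _, h.symm⟩
  · rintro ⟨p, -, rfl⟩
    exact starLink_mem_vertexStar s p.1 p.2

/-- **Sums over the vertex star in coordinates** (torus of side `≥ 2`):
`Σ_{x ∈ ⋆} g x = Σ_{(μ, o)} g (starLink s μ o)`. -/
theorem sum_vertexStar_eq_sum_starLink (hL : 1 < L) {M : Type*} [AddCommMonoid M] (s : Site d L)
    (g : Edge d L → M) : ∑ x ∈ vertexStar s, g x = ∑ p : Fin d × Bool, g (starLink s p.1 p.2) := by
  rw [vertexStar_eq_image_starLink, sum_image fun p _ p' _ h => starLink_injective hL s h]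

/-- **The vertex star has `2d` links** (torus of side `≥ 2`). -/
theorem card_vertexStar (hL : 1 < L) (s : Site d L) : (vertexStar s).card = 2 * d := by
  rw [vertexStar_eq_image_starLink, card_image_of_injective _ (starLink_injective hL s), card_univ,
    Fintype.card_prod, Fintype.card_fin, Fintype.card_bool, mul_comm]

end Coordinates

/-! ### (C2) The star plaquettes in coordinates -/

section Plaquettes

/-- **The star plaquette spanned by the star links of directions `μ ≠ ν` and orientations `o, o'`**:
the plaquette through `starLink s μ o` in the plane `{μ, ν}` on the side of `starLink s ν o'`. -/
def starPlaqOf (s : Site d L) (μ : Fin d) (o : Bool) (ν : Fin d) (o' : Bool) (h : μ ≠ ν) :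
    Plaquette d L :=
  plaqOf (starLink s μ o).1 μ ν h o'

omit [NeZero L] in
/-- The first star link lies on `starPlaqOf`. -/
theorem starLink_mem_starPlaqOf_left (s : Site d L) (μ : Fin d) (o : Bool) (ν : Fin d) (o' : Bool)
    (h : μ ≠ ν) : starLink s μ o ∈ plaqEdgesT (starPlaqOf s μ o ν o' h) :=
  self_mem_plaqEdgesT_plaqOf _ h o'

omit [NeZero L] in
/-- The second star link lies on `starPlaqOf` (the four orientation cases). -/
theorem starLink_mem_starPlaqOf_right (s : Site d L) (μ : Fin d) (o : Bool) (ν : Fin d) (o' : Bool)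
    (h : μ ≠ ν) : starLink s ν o' ∈ plaqEdgesT (starPlaqOf s μ o ν o' h) := by
  rw [starPlaqOf, mem_plaqEdgesT_plaqOf]
  cases o <;> cases o'
  · refine Or.inr (Or.inl (Prod.ext ?_ rfl))
    simp only [starLink, plaqBase, Bool.false_eq_true, ↓reduceIte, shift_def]
    abel
  · exact Or.inr (Or.inl (Prod.ext (by simp [starLink, plaqBase, shift_def]) rfl))
  · exact Or.inr (Or.inr (Or.inr (Prod.ext (by simp [starLink, plaqBase]) rfl)))
  · exact Or.inr (Or.inr (Or.inr (Prod.ext (by simp [starLink, plaqBase]) rfl)))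

/-- `starPlaqOf` is a star plaquette. -/
theorem starPlaqOf_mem_starPlaqs (s : Site d L) (μ : Fin d) (o : Bool) (ν : Fin d) (o' : Bool)
    (h : μ ≠ ν) : starPlaqOf s μ o ν o' h ∈ starPlaqs s :=
  mem_starPlaqs.2 ⟨_, starLink_mem_starPlaqOf_left s μ o ν o' h, starLink_mem_vertexStar s μ o⟩

omit [NeZero L] in
/-- Star links of different directions differ. -/
theorem starLink_ne (s : Site d L) {μ ν : Fin d} (h : μ ≠ ν) (o o' : Bool) :
    starLink s μ o ≠ starLink s ν o' :=
  fun e => h (congrArg Prod.snd e)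

omit [NeZero L] in
/-- **Symmetry**: the star plaquette of `(μ, o; ν, o')` is that of `(ν, o'; μ, o)` (side `≥ 3`). -/
theorem starPlaqOf_swap (hL : 3 ≤ L) (s : Site d L) {μ ν : Fin d} (h : μ ≠ ν) (o o' : Bool) :
    starPlaqOf s μ o ν o' h = starPlaqOf s ν o' μ o h.symm :=
  eq_of_two_mem hL (starLink_ne s h o o') (starLink_mem_starPlaqOf_left s μ o ν o' h)
    (starLink_mem_starPlaqOf_right s μ o ν o' h) (starLink_mem_starPlaqOf_right s ν o' μ o h.symm)
    (starLink_mem_starPlaqOf_left s ν o' μ o h.symm)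

/-- **Two distinct star links on a common plaquette have different directions** (opposite links share
no plaquette; side `≥ 2`). -/
theorem snd_ne_of_mem_starPlaq (hL : 1 < L) {s : Site d L} {q : Plaquette d L} {a b : Edge d L}
    (ha : a ∈ vertexStar s) (hb : b ∈ vertexStar s) (hab : a ≠ b) (haq : a ∈ plaqEdgesT q)
    (hbq : b ∈ plaqEdgesT q) : a.2 ≠ b.2 := by
  intro hdir
  have h0 := jointPlaq_eq_zero_of_vertexStar_of_snd_eq hL ha hb hab hdir
  rw [jointPlaq_eq_zero_iff] at h0
  exact h0 q haq hbq

/-- Two star links of different directions lie on a common plaquette (side `≥ 3`). -/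
theorem exists_plaq_of_snd_ne (hL : 3 ≤ L) {s : Site d L} {a b : Edge d L} (ha : a ∈ vertexStar s)
    (hb : b ∈ vertexStar s) (hdir : a.2 ≠ b.2) :
    ∃ q : Plaquette d L, a ∈ plaqEdgesT q ∧ b ∈ plaqEdgesT q := by
  have h1 := jointPlaq_eq_one_of_vertexStar_of_snd_ne hL ha hb hdir
  unfold jointPlaq at h1
  obtain ⟨q, hq⟩ := card_pos.1 (by omega :
    0 < ((plaqsThrough a).filter fun q => b ∈ plaqEdgesT q).card)
  rw [mem_filter, mem_plaqsThrough] at hq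
  exact ⟨q, hq.1, hq.2⟩

/-- **Every star plaquette is a `starPlaqOf`** (side `≥ 3`): read off its two star links. -/
theorem exists_starPlaqOf_eq (hL : 3 ≤ L) {s : Site d L} {q : Plaquette d L} (hq : q ∈ starPlaqs s) :
    ∃ (μ : Fin d) (o : Bool) (ν : Fin d) (o' : Bool) (h : μ ≠ ν), q = starPlaqOf s μ o ν o' h := by
  have hL1 : 1 < L := by omega
  obtain ⟨a, b, hab, hf⟩ := filter_mem_vertexStar_plaqEdgesT hL1 hq
  have ha : a ∈ (plaqEdgesT q).filter (fun e => e ∈ vertexStar s) := by rw [hf]; simp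
  have hb : b ∈ (plaqEdgesT q).filter (fun e => e ∈ vertexStar s) := by rw [hf]; simp
  rw [mem_filter] at ha hb
  have hdir := snd_ne_of_mem_starPlaq hL1 ha.2 hb.2 hab ha.1 hb.1
  obtain ⟨o, hao⟩ := eq_starLink_of_mem_vertexStar ha.2
  obtain ⟨o', hbo⟩ := eq_starLink_of_mem_vertexStar hb.2
  refine ⟨a.2, o, b.2, o', hdir, eq_of_two_mem hL hab ha.1 hb.1 ?_ ?_⟩
  · have h := starLink_mem_starPlaqOf_left s a.2 o b.2 o' hdir
    rwa [← hao] at h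
  · have h := starLink_mem_starPlaqOf_right s a.2 o b.2 o' hdir
    rwa [← hbo] at h

/-- **The star links of `starPlaqOf` are exactly the two named ones** (side `≥ 2`). -/
theorem filter_vertexStar_starPlaqOf (hL : 1 < L) (s : Site d L) {μ ν : Fin d} (h : μ ≠ ν)
    (o o' : Bool) :
    (plaqEdgesT (starPlaqOf s μ o ν o' h)).filter (fun e => e ∈ vertexStar s) =
      {starLink s μ o, starLink s ν o'} := by
  obtain ⟨a, b, hab, hf⟩ := filter_mem_vertexStar_plaqEdgesT hL (starPlaqOf_mem_starPlaqs s μ o ν o' h)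
  rw [hf]
  have h1 : starLink s μ o ∈ ({a, b} : Finset (Edge d L)) := by
    rw [← hf, mem_filter]
    exact ⟨starLink_mem_starPlaqOf_left s μ o ν o' h, starLink_mem_vertexStar s μ o⟩
  have h2 : starLink s ν o' ∈ ({a, b} : Finset (Edge d L)) := by
    rw [← hf, mem_filter]
    exact ⟨starLink_mem_starPlaqOf_right s μ o ν o' h, starLink_mem_vertexStar s ν o'⟩
  symm
  refine eq_of_subset_of_card_le (fun x hx => ?_) ?_
  · simp only [mem_insert, mem_singleton] at hx
    rcases hx with rfl | rfl
    · exact h1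
    · exact h2
  · rw [card_pair hab, card_pair (starLink_ne s h o o')]

end Plaquettes

/-! ### (C3) Regrouping: star plaquettes ↔ ordered non-opposite star pairs -/

section Regroup

/-- The ordered pairs of distinct star links of a plaquette. -/
def starPairsOf (s : Site d L) (q : Plaquette d L) : Finset (Edge d L × Edge d L) :=
  (((plaqEdgesT q).filter fun e => e ∈ vertexStar s) ×ˢ
    ((plaqEdgesT q).filter fun e => e ∈ vertexStar s)).filter fun ab => ab.1 ≠ ab.2

/-- The ordered pairs of non-opposite (different-direction) star links. -/
def starPairs (s : Site d L) : Finset (Edge d L × Edge d L) :=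
  (vertexStar s ×ˢ vertexStar s).filter fun ab => ab.2.2 ≠ ab.1.2

/-- Membership in `starPairsOf`. -/
theorem mem_starPairsOf {s : Site d L} {q : Plaquette d L} {ab : Edge d L × Edge d L} :
    ab ∈ starPairsOf s q ↔ (ab.1 ∈ plaqEdgesT q ∧ ab.1 ∈ vertexStar s) ∧
      (ab.2 ∈ plaqEdgesT q ∧ ab.2 ∈ vertexStar s) ∧ ab.1 ≠ ab.2 := by
  simp only [starPairsOf, mem_filter, mem_product, and_assoc]

/-- Membership in `starPairs`. -/
theorem mem_starPairs {s : Site d L} {ab : Edge d L × Edge d L} :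
    ab ∈ starPairs s ↔ ab.1 ∈ vertexStar s ∧ ab.2 ∈ vertexStar s ∧ ab.2.2 ≠ ab.1.2 := by
  simp only [starPairs, mem_filter, mem_product, and_assoc]

/-- **The ordered non-opposite star pairs are the disjoint union, over the star plaquettes, of the
ordered star pairs of each plaquette** (side `≥ 3`). -/
theorem starPairs_eq_biUnion (hL : 3 ≤ L) (s : Site d L) :
    starPairs s = (starPlaqs s).biUnion (starPairsOf s) := by
  have hL1 : 1 < L := by omega
  ext ⟨a, b⟩
  rw [mem_starPairs, mem_biUnion]
  constructor
  · rintro ⟨ha, hb, hdir⟩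
    obtain ⟨q, haq, hbq⟩ := exists_plaq_of_snd_ne hL ha hb (Ne.symm hdir)
    exact ⟨q, mem_starPlaqs.2 ⟨a, haq, ha⟩,
      mem_starPairsOf.2 ⟨⟨haq, ha⟩, ⟨hbq, hb⟩, fun h => hdir (by simp only at h; rw [h])⟩⟩
  · rintro ⟨q, -, hab⟩
    obtain ⟨⟨haq, ha⟩, ⟨hbq, hb⟩, hne⟩ := mem_starPairsOf.1 hab
    exact ⟨ha, hb, Ne.symm (snd_ne_of_mem_starPlaq hL1 ha hb hne haq hbq)⟩

/-- The star-pair sets of distinct star plaquettes are disjoint (two distinct links determine the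
plaquette; side `≥ 3`). -/
theorem pairwiseDisjoint_starPairsOf (hL : 3 ≤ L) (s : Site d L) :
    (↑(starPlaqs s) : Set (Plaquette d L)).PairwiseDisjoint (starPairsOf s) := by
  intro q _ q' _ hqq'
  rw [Function.onFun, disjoint_left]
  intro ab h1 h2
  obtain ⟨⟨haq, -⟩, ⟨hbq, -⟩, hne⟩ := mem_starPairsOf.1 h1
  obtain ⟨⟨haq', -⟩, ⟨hbq', -⟩, -⟩ := mem_starPairsOf.1 h2
  exact hqq' (eq_of_two_mem hL hne haq hbq haq' hbq')

/-- **THE REGROUPING IDENTITY** (side `≥ 3`): summing `k a b` over the star plaquettes `q` and the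
ordered pairs of distinct star links of `q` is summing over all ordered NON-OPPOSITE star pairs —
each such pair lies on exactly one star plaquette. (B4-BLUEPRINT §4: with two boundary links per star
plaquette this turns `Σ_y K(s; y → x)` into `c · Σ_{(a,b) non-opposite, a ≠ x} D^{(a)}(x; b)`.) -/
theorem sum_starPlaqs_pairs (hL : 3 ≤ L) {M : Type*} [AddCommMonoid M] (s : Site d L)
    (k : Edge d L → Edge d L → M) :
    ∑ q ∈ starPlaqs s, ∑ ab ∈ starPairsOf s q, k ab.1 ab.2 = ∑ ab ∈ starPairs s, k ab.1 ab.2 := by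
  rw [starPairs_eq_biUnion hL s, sum_biUnion (pairwiseDisjoint_starPairsOf hL s)]

/-- The same identity with iterated sums on the right:
`Σ_q Σ_{(a,b) ∈ starPairsOf q} k a b = Σ_{a ∈ ⋆} Σ_{b ∈ ⋆, b.2 ≠ a.2} k a b`. -/
theorem sum_starPlaqs_pairs' (hL : 3 ≤ L) {M : Type*} [AddCommMonoid M] (s : Site d L)
    (k : Edge d L → Edge d L → M) :
    ∑ q ∈ starPlaqs s, ∑ ab ∈ starPairsOf s q, k ab.1 ab.2 =
      ∑ a ∈ vertexStar s, ∑ b ∈ (vertexStar s).filter (fun b => b.2 ≠ a.2), k a b := by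
  rw [sum_starPlaqs_pairs hL s k, starPairs, sum_filter, sum_product]
  refine sum_congr rfl fun a _ => ?_
  rw [sum_filter]

/-- **The ordered non-opposite star pairs in coordinates** (torus of side `≥ 2`): a sum over
`starPairs s` is a sum over the pairs `(p, p')` of `(direction, orientation)` data with `p'.1 ≠ p.1`
(the index set `pairSet`-style of the abstract star `Fin d × Bool`). -/
theorem sum_starPairs_eq_sum_starLink (hL : 1 < L) {M : Type*} [AddCommMonoid M] (s : Site d L)
    (k : Edge d L → Edge d L → M) :
    ∑ ab ∈ starPairs s, k ab.1 ab.2 =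
      ∑ p : Fin d × Bool, ∑ p' ∈ (univ : Finset (Fin d × Bool)).filter (fun p' => p'.1 ≠ p.1),
        k (starLink s p.1 p.2) (starLink s p'.1 p'.2) := by
  rw [starPairs, sum_filter, sum_product, sum_vertexStar_eq_sum_starLink hL]
  refine sum_congr rfl fun p _ => ?_
  rw [sum_filter, sum_vertexStar_eq_sum_starLink hL]
  simp only [starLink_snd]

/-- The same with the right side indexed by the filtered product (the shape of the abstract star's
`pairSet`, `StarColumn.lean`): pairs `pp : (Fin d × Bool) × (Fin d × Bool)` with `pp.1.1 ≠ pp.2.1`. -/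
theorem sum_starPairs_eq_sum_dirPairs (hL : 1 < L) {M : Type*} [AddCommMonoid M] (s : Site d L)
    (k : Edge d L → Edge d L → M) :
    ∑ ab ∈ starPairs s, k ab.1 ab.2 =
      ∑ pp ∈ (univ : Finset ((Fin d × Bool) × (Fin d × Bool))).filter (fun pp => pp.1.1 ≠ pp.2.1),
        k (starLink s pp.1.1 pp.1.2) (starLink s pp.2.1 pp.2.2) := by
  rw [sum_starPairs_eq_sum_starLink hL s k]
  exact (sum_finset_product ((univ : Finset ((Fin d × Bool) × (Fin d × Bool))).filter
      fun pp => pp.1.1 ≠ pp.2.1) univ (fun p => (univ : Finset (Fin d × Bool)).filter fun p' => p'.1 ≠ p.1)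
    (fun pp => by simp only [mem_filter, mem_univ, true_and, ne_comm])
    (f := fun pp => k (starLink s pp.1.1 pp.1.2) (starLink s pp.2.1 pp.2.2))).symm

/-- The ordered star pairs of `starPlaqOf s μ o ν o' h` are the two orderings of its star links
(side `≥ 2`). -/
theorem starPairsOf_starPlaqOf (hL : 1 < L) (s : Site d L) {μ ν : Fin d} (h : μ ≠ ν) (o o' : Bool) :
    starPairsOf s (starPlaqOf s μ o ν o' h) =
      {(starLink s μ o, starLink s ν o'), (starLink s ν o', starLink s μ o)} := by
  have hne := starLink_ne s h o o'
  rw [starPairsOf, filter_vertexStar_starPlaqOf hL s h o o']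
  ext ⟨a, b⟩
  simp only [mem_filter, mem_product, mem_insert, mem_singleton, Prod.mk.injEq]
  constructor
  · rintro ⟨⟨ha | ha, hb | hb⟩, hab⟩ <;> subst ha <;> subst hb
    · exact absurd rfl hab
    · exact Or.inl ⟨rfl, rfl⟩
    · exact Or.inr ⟨rfl, rfl⟩
    · exact absurd rfl hab
  · rintro (⟨rfl, rfl⟩ | ⟨rfl, rfl⟩)
    · exact ⟨⟨Or.inl rfl, Or.inr rfl⟩, hne⟩
    · exact ⟨⟨Or.inr rfl, Or.inl rfl⟩, hne.symm⟩

/-- A sum over the ordered star pairs of `starPlaqOf s μ o ν o' h` has the two terms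
`k a b + k b a` (side `≥ 2`). -/
theorem sum_starPairsOf_starPlaqOf (hL : 1 < L) {M : Type*} [AddCommMonoid M] (s : Site d L)
    {μ ν : Fin d} (h : μ ≠ ν) (o o' : Bool) (k : Edge d L → Edge d L → M) :
    ∑ ab ∈ starPairsOf s (starPlaqOf s μ o ν o' h), k ab.1 ab.2 =
      k (starLink s μ o) (starLink s ν o') + k (starLink s ν o') (starLink s μ o) := by
  have hne := starLink_ne s h o o'
  rw [starPairsOf_starPlaqOf hL s h o o', sum_pair]
  intro heq
  exact hne (Prod.mk.inj heq).1

end Regroup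

end Summit.Ventures.YMGap.StarKernel

end
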